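import Summits.Ventures.HodgeRepro2.T5BergmanSchurGeneral

/-!
# The general Schur relation against every Haar measure of `SU(1,1)`

`T5BergmanSchurGeneral.integral_norm_matrixCoeff_sq_ruhl` gives
`∫_G |⟨π_k(g) f, h⟩_k|² dμ_R = ⟨f, f⟩_k ⟨h, h⟩_k / (k - 1)` against Rühl's measure `μ_R = ν/π`
(`T5SU11CoefficientL2.ruhl`), for all holomorphic `f, h ∈ A_k`, `k ≥ 2`. This file transports it to the
fibration measure `ν` (`integral_norm_matrixCoeff_sq_nu`: the value is `π ⟨f,f⟩_k ⟨h,h⟩_k / (k - 1)`)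
and to EVERY Haar measure `μ` of `SU(1,1)` (`integral_norm_matrixCoeff_sq_haar`):

  `c_μ • ∫_G |⟨π_k(g) f, h⟩_k|² dμ = π ⟨f, f⟩_k ⟨h, h⟩_k / (k - 1)`,   `c_μ = haarScalarFactor ν μ`,

the form `T5BergmanSchur.integral_norm_coeffLowest_sq` had for the pair `(1, h)`; the matrix coefficient
is square-integrable against every Haar measure (`integrable_norm_matrixCoeff_sq_haar`).

Blind lane: Mathlib + the HodgeRepro2 prefix only; no sorry; axioms ⊆ {propext, Classical.choice,
Quot.sound}.
-/

namespace Summit.Ventures.HodgeRepro2.T5BergmanSchurHaar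

open MeasureTheory MeasureTheory.Measure Metric Filter Topology
open T5PoincareDensity T5SU11Unimodular T5SU11Fibration T5HaarCircle T5SU11FibrationHaar
  T5SU11CoefficientL2
open T5BergmanCoefficient T5BergmanPairing T5BergmanUnitary T5BergmanParseval T5BergmanActStable
  T5BergmanMatrixCoeff T5BergmanSchurGeneral
open scoped Real ENNReal

variable [MeasurableSpace Circle] [BorelSpace Circle]

/-- **Against the fibration measure `ν`** (`μ_R = ν/π`): `∫_G |⟨π_k(g) f, h⟩_k|² dν = π ⟨f,f⟩_k ⟨h,h⟩_k/(k-1)`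
for holomorphic `f = Σ a_m zᵐ`, `h = Σ b_n zⁿ` in `A_k`, and the integrand is `ν`-integrable. -/
theorem integral_norm_matrixCoeff_sq_nu (k : ℕ) (hk : 2 ≤ k) (a : ℕ → ℂ) (f : ℂ → ℂ)
    (hf : DifferentiableOn ℂ f (ball 0 1))
    (hfa : ∀ w ∈ ball (0 : ℂ) 1, HasSum (fun m => a m * w ^ m) (f w))
    (hfint : IntegrableOn (fun w => ‖f w‖ ^ 2 * (1 - ‖w‖ ^ 2) ^ (k - 2)) (ball (0 : ℂ) 1))
    (b : ℕ → ℂ) (h : ℂ → ℂ) (hh : ∀ w ∈ ball (0 : ℂ) 1, HasSum (fun n => b n * w ^ n) (h w))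
    (hhint : IntegrableOn (fun w => ‖h w‖ ^ 2 * (1 - ‖w‖ ^ 2) ^ (k - 2)) (ball (0 : ℂ) 1)) :
    Integrable (fun g => ‖matrixCoeff k f h g‖ ^ 2) (nu haarCircle) ∧
      ∫ g, ‖matrixCoeff k f h g‖ ^ 2 ∂(nu haarCircle) =
        π * ((pairing k f f).re * (pairing k h h).re / ((k : ℝ) - 1)) := by
  obtain ⟨hi, he⟩ := integral_norm_matrixCoeff_sq_ruhl k hk a f hf hfa hfint b h hh hhint
  have hπ : (0 : ℝ) < π := Real.pi_pos
  have hc0 : ENNReal.ofReal π⁻¹ ≠ 0 := by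
    rw [Ne, ENNReal.ofReal_eq_zero]
    exact not_le.mpr (inv_pos.mpr hπ)
  unfold ruhl at hi he
  rw [integrable_smul_measure hc0 ENNReal.ofReal_ne_top] at hi
  rw [integral_smul_measure, ENNReal.toReal_ofReal (by positivity), smul_eq_mul] at he
  refine ⟨hi, ?_⟩
  rw [← he]
  field_simp

/-- **Square-integrability against every Haar measure**: `g ↦ |⟨π_k(g) f, h⟩_k|²` is `μ`-integrable for
every Haar measure `μ` of `SU(1,1)` and all holomorphic `f, h ∈ A_k`. -/
theorem integrable_norm_matrixCoeff_sq_haar (μ : Measure SU11) [IsHaarMeasure μ] (k : ℕ) (hk : 2 ≤ k)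
    (a : ℕ → ℂ) (f : ℂ → ℂ) (hf : DifferentiableOn ℂ f (ball 0 1))
    (hfa : ∀ w ∈ ball (0 : ℂ) 1, HasSum (fun m => a m * w ^ m) (f w))
    (hfint : IntegrableOn (fun w => ‖f w‖ ^ 2 * (1 - ‖w‖ ^ 2) ^ (k - 2)) (ball (0 : ℂ) 1))
    (b : ℕ → ℂ) (h : ℂ → ℂ) (hh : ∀ w ∈ ball (0 : ℂ) 1, HasSum (fun n => b n * w ^ n) (h w))
    (hhint : IntegrableOn (fun w => ‖h w‖ ^ 2 * (1 - ‖w‖ ^ 2) ^ (k - 2)) (ball (0 : ℂ) 1)) :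
    Integrable (fun g => ‖matrixCoeff k f h g‖ ^ 2) μ := by
  have hi := (integral_norm_matrixCoeff_sq_nu k hk a f hf hfa hfint b h hh hhint).1
  have hc0 : haarScalarFactor (nu haarCircle) μ ≠ 0 := (haarScalarFactor_nu_pos haarCircle μ).ne'
  rw [nu_eq_smul haarCircle μ] at hi
  exact (integrable_smul_measure (ENNReal.coe_ne_zero.mpr hc0) ENNReal.coe_ne_top).mp hi

/-- **The general Schur relation against every Haar measure**:
`c_μ • ∫_G |⟨π_k(g) f, h⟩_k|² dμ = π ⟨f,f⟩_k ⟨h,h⟩_k / (k-1)`, `c_μ = haarScalarFactor ν μ`, for every Haar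
measure `μ` of `SU(1,1)` and all holomorphic `f = Σ a_m zᵐ`, `h = Σ b_n zⁿ` in `A_k`. -/
theorem integral_norm_matrixCoeff_sq_haar (μ : Measure SU11) [IsHaarMeasure μ] (k : ℕ) (hk : 2 ≤ k)
    (a : ℕ → ℂ) (f : ℂ → ℂ) (hf : DifferentiableOn ℂ f (ball 0 1))
    (hfa : ∀ w ∈ ball (0 : ℂ) 1, HasSum (fun m => a m * w ^ m) (f w))
    (hfint : IntegrableOn (fun w => ‖f w‖ ^ 2 * (1 - ‖w‖ ^ 2) ^ (k - 2)) (ball (0 : ℂ) 1))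
    (b : ℕ → ℂ) (h : ℂ → ℂ) (hh : ∀ w ∈ ball (0 : ℂ) 1, HasSum (fun n => b n * w ^ n) (h w))
    (hhint : IntegrableOn (fun w => ‖h w‖ ^ 2 * (1 - ‖w‖ ^ 2) ^ (k - 2)) (ball (0 : ℂ) 1)) :
    (haarScalarFactor (nu haarCircle) μ : ℝ) • ∫ g, ‖matrixCoeff k f h g‖ ^ 2 ∂μ =
      π * ((pairing k f f).re * (pairing k h h).re / ((k : ℝ) - 1)) := by
  have he := (integral_norm_matrixCoeff_sq_nu k hk a f hf hfa hfint b h hh hhint).2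
  rw [nu_eq_smul haarCircle μ, integral_smul_nnreal_measure] at he
  exact he

/-- The same, solved for the integral:
`∫_G |⟨π_k(g) f, h⟩_k|² dμ = π ⟨f,f⟩_k ⟨h,h⟩_k / ((k-1) c_μ)`. -/
theorem integral_norm_matrixCoeff_sq_haar_eq (μ : Measure SU11) [IsHaarMeasure μ] (k : ℕ) (hk : 2 ≤ k)
    (a : ℕ → ℂ) (f : ℂ → ℂ) (hf : DifferentiableOn ℂ f (ball 0 1))
    (hfa : ∀ w ∈ ball (0 : ℂ) 1, HasSum (fun m => a m * w ^ m) (f w))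
    (hfint : IntegrableOn (fun w => ‖f w‖ ^ 2 * (1 - ‖w‖ ^ 2) ^ (k - 2)) (ball (0 : ℂ) 1))
    (b : ℕ → ℂ) (h : ℂ → ℂ) (hh : ∀ w ∈ ball (0 : ℂ) 1, HasSum (fun n => b n * w ^ n) (h w))
    (hhint : IntegrableOn (fun w => ‖h w‖ ^ 2 * (1 - ‖w‖ ^ 2) ^ (k - 2)) (ball (0 : ℂ) 1)) :
    ∫ g, ‖matrixCoeff k f h g‖ ^ 2 ∂μ =
      π * ((pairing k f f).re * (pairing k h h).re) /
        (((k : ℝ) - 1) * (haarScalarFactor (nu haarCircle) μ : ℝ)) := by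
  have he := integral_norm_matrixCoeff_sq_haar μ k hk a f hf hfa hfint b h hh hhint
  have hc : (0 : ℝ) < (haarScalarFactor (nu haarCircle) μ : ℝ) := by
    exact_mod_cast haarScalarFactor_nu_pos haarCircle μ
  have hk1 : (0 : ℝ) < (k : ℝ) - 1 := by
    have : (2 : ℝ) ≤ k := by exact_mod_cast hk
    linarith
  rw [smul_eq_mul] at he
  have he' : ((k : ℝ) - 1) * ((haarScalarFactor (nu haarCircle) μ : ℝ) *
      ∫ g, ‖matrixCoeff k f h g‖ ^ 2 ∂μ) = π * ((pairing k f f).re * (pairing k h h).re) := by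
    rw [he]
    field_simp
  rw [eq_div_iff (mul_ne_zero hk1.ne' hc.ne')]
  linear_combination he'

/-- **`schur_haar`**: the relation in the `pairing k (act k g f) h` spelling, for holomorphic `f, h ∈ A_k`
without naming their Taylor coefficients. -/
theorem schur_haar (μ : Measure SU11) [IsHaarMeasure μ] (k : ℕ) (hk : 2 ≤ k) (f h : ℂ → ℂ)
    (hf : DifferentiableOn ℂ f (ball 0 1))
    (hfint : IntegrableOn (fun w => ‖f w‖ ^ 2 * (1 - ‖w‖ ^ 2) ^ (k - 2)) (ball (0 : ℂ) 1))
    (hh : DifferentiableOn ℂ h (ball 0 1))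
    (hhint : IntegrableOn (fun w => ‖h w‖ ^ 2 * (1 - ‖w‖ ^ 2) ^ (k - 2)) (ball (0 : ℂ) 1)) :
    (haarScalarFactor (nu haarCircle) μ : ℝ) • ∫ g, ‖pairing k (act k g f) h‖ ^ 2 ∂μ =
      π * ((pairing k f f).re * (pairing k h h).re / ((k : ℝ) - 1)) :=
  integral_norm_matrixCoeff_sq_haar μ k hk _ f hf (hasSum_taylor f hf) hfint _ h (hasSum_taylor h hh)
    hhint

/-- The integrand of `schur_haar` is `μ`-integrable. -/
theorem integrable_schur_haar (μ : Measure SU11) [IsHaarMeasure μ] (k : ℕ) (hk : 2 ≤ k) (f h : ℂ → ℂ)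
    (hf : DifferentiableOn ℂ f (ball 0 1))
    (hfint : IntegrableOn (fun w => ‖f w‖ ^ 2 * (1 - ‖w‖ ^ 2) ^ (k - 2)) (ball (0 : ℂ) 1))
    (hh : DifferentiableOn ℂ h (ball 0 1))
    (hhint : IntegrableOn (fun w => ‖h w‖ ^ 2 * (1 - ‖w‖ ^ 2) ^ (k - 2)) (ball (0 : ℂ) 1)) :
    Integrable (fun g => ‖pairing k (act k g f) h‖ ^ 2) μ :=
  integrable_norm_matrixCoeff_sq_haar μ k hk _ f hf (hasSum_taylor f hf) hfint _ h
    (hasSum_taylor h hh) hhint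

end Summit.Ventures.HodgeRepro2.T5BergmanSchurHaar
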